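import Summits.SmoothPoincare4.SmoothPoincare4.Theses.CongruenceShadows
import Summits.SmoothPoincare4.SmoothPoincare4.Theses.GroupTrisection
import Summits.SmoothPoincare4.SmoothPoincare4.Theorems.CongruenceShadowsAgkCor6SufficiencyStubCoredReassembly
import Summits.SmoothPoincare4.SmoothPoincare4.Theorems.CongruenceShadowsAgkCor6SufficiencyStubDehnNielsenBaer
import Summits.SmoothPoincare4.SmoothPoincare4.Theorems.CongruenceShadowsAgkCor6SufficiencyStubHandlebodyExtension
import Summits.SmoothPoincare4.SmoothPoincare4.Theorems.CongruenceShadowsAgkCor6SufficiencyStubSectorCoresHelpers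
import Summits.SmoothPoincare4.SmoothPoincare4.Theorems.CongruenceShadowsAgkCor6SufficiencyStubSectorCoresLevelFunction
import Literature.Topology.FourManifolds.TrisectionFunctorSPC4Proofs
import Literature.Topology.FourManifolds.TrisectionsProofs
import Literature.Topology.FourManifolds.TrisectionsTriNormalForm
import Literature.Topology.FourManifolds.TrisectionsSectorRecognition
import Literature.Topology.FourManifolds.TrisectionsSectorClauses
import Literature.Topology.FourManifolds.RegularLevelSplitting
import Literature.Topology.FourManifolds.RegularDomainMaps
import Literature.Topology.FourManifolds.BoundaryCollarMatching
import Literature.Topology.FourManifolds.HandlebodyKernelExtension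
import Literature.Topology.FourManifolds.DehnNielsenBaerSurface

/-!
# Line `lp-by-sphere-system-surgery` — skeleton for crux `AgkCor6Sufficiency` (stmt-SmoothPoincare4-10894)

**Lead reshape r5** (prover-line-stmt-SmoothPoincare4-10894-1, 2026-08-16).  The composition above
`SpineRigidityWithCores` is UNCHANGED (r3/r4; the glue stubs are landed and imported here):

  `AgkCor6Sufficiency ⇐ (b′) + (c′)` (`cruxBody_of_two_leaves`),
  `(b′) ⇐ GeometricRigidity + DehnNielsenBaerCentral` (`rigidity_of_geometricRigidity_of_dnb`),
  `GeometricRigidity ⇐ SpineRigidityWithCores + CoredReassembly` (`geometricRigidity_of_spine_of_cored`),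
  `FillingUniqueness ⇐ LP` (landed p89425), `HandlebodyExtension ⇐ Griffiths` (p90856),
  `DehnNielsenBaerCentral ⇐ DNB-surface` (p94067), `CoredReassembly ⇐ FU` (p94506).

What changes is the proof of `SpineRigidityWithCores` (formerly `stub_sectorCores` + `stub_prismRigidity`).
`PrismRigidity` (r4) quantified over ARBITRARY clause-(ii) sector data on both sides; two straightenings
of one sector differ along the corner stratum by a homeomorphism that is only Hölder, so comparing
prisms of arbitrary abstract sectors is an end-uniqueness problem.  r5 never compares abstract sector
structures: on both sides it uses the tree's RIGID Θ-standard sectors `↥(S m)` (corner-slice atlases over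
one normal frame `(u, v, ρ)`, `IsGKTrisection.exists_triNormalForm` +
`exists_cornerSliceAtlas_hasHandleDecomposition_of_ambient`), for which a map preserving `(u, v)` and
intertwining `ρ` is smooth for the straightened structures.  Registered stubs:

* `stub_thetaData` — Θ-standard data of a GK trisection (tree plumbing);
* `stub_tubularZone` — the disc-bundle zone `Z ≅ F × D_r` of a normal frame: injectivity of `(ρ,u,v)`,
  the smooth fibrewise translation action `A`;
* `stub_zoneMap` — from two frames and the ambiently smooth `ψ : F ≃ F'`, the zone map `G`
  (`u' ∘ G = u`, `v' ∘ G = v`, `ρ' ∘ G = G ∘ ρ`, `G|F = ψ`) with inverse;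
* `stub_handlebodyMatch` — `HandlebodyExtension` ⇒ a diffeomorphism of the abstract handlebodies of a seam
  which agrees with `G` near `∂H` (collar uniqueness, `BoundaryCollarMatching`);
* `stub_spineGerm` (lead) — the spine germ: a diffeomorphism `G₀ : U₀ ≅ U₀'` of open neighbourhoods of the
  spines, sector-preserving, equal to `G` near `F` (seam bicollars standard in the zone, flow conjugation,
  injectivity near the spine);
* `stub_standardCores` — Step A for PRESCRIBED clause-(ii) data, prescribed boundary data and thin collars
  (the landed `stub_sectorCores` proof, re-run);
* `stub_collarTransport` — transport of boundary data and thin collars of a Θ-standard sector along `G₀`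
  (smoothness of `G₀` for the straightened structures);
* `stub_coreIndependence` — cores of a compact manifold with boundary do not depend on the collar
  (isotopy extension in the interior);
* `stub_prismIndependence` — hence the prism neighbourhood of the spine does not depend on the collars,
  up to a diffeomorphism of `X`;
* `stub_sublevelTransfer` — a partial diffeomorphism around two regular sublevel sets carrying one onto
  the other induces a diffeomorphism of the `RegularSublevel` manifolds;
* delegated named facts, unchanged: `stub_laudenbachPoenaru` (LP), `stub_griffiths`, `stub_dnbSurface`,
  `stub_stabilization` ((c′)).

Glue proved here: `spineRigidityWithCores_of_stubs`, `AgkCor6Sufficiency_of_stubStatements`,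
`AgkCor6Sufficiency_of`, `AgkCor6Sufficiency_of'`.
Disproof.lean (cycles 1–4) honoured: no `_false_without_` beyond `WithoutHyp = SPC4`; the hypothesis `X`
is used through `spc4_of_forall_isStablyTrivial_of_three_leaves`; no stub mentions `X`.
-/

set_option linter.dupNamespace false

noncomputable section

open Set Function ContinuousMap
open scoped Manifold ContDiff Topology

namespace Summit.SmoothPoincare4.SmoothPoincare4.Cruxes.AgkCor6Sufficiency.LpBySphereSystemSurgery

open Literature.Topology.FourManifolds
open Summit.SmoothPoincare4.SmoothPoincare4.Theses.CongruenceShadows (AgkCor6Sufficiency)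

/-! ## 0. The crux is (b′) + (c′) (tree assembly, GK Thm 4 discharged) -/

/-- The BODY of the crux (both route decls `CongruenceShadows.AgkCor6Sufficiency` and
`GroupTrisection.AgkCor6Sufficiency` unfold to it verbatim) from the two AGK leaves (b′), (c′) alone. -/
theorem cruxBody_of_two_leaves (hb : diffeomorph_of_iso_groupGKTrisectionOf.{0})
    (hc : exists_stabilized_gkTrisection.{0}) :
    (∀ (k : ℕ) (K : TrisectionKernels (3 * k)),
        IsGroupTrisection (3 * k) k (PUnit : Type) K → K.IsStablyTrivial) →
      ∀ (M : Type) [TopologicalSpace M] [T2Space M] [SecondCountableTopology M],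
        ContinuousMap.HomotopyEquiv.NonemptyDiffeomorphSphere M 4 :=
  fun hst M _ _ _ =>
    spc4_of_forall_isStablyTrivial_of_three_leaves exists_isBalancedGKTrisection_holds hb hc hst M

/-! ## 1. The statements of the line above the spine (r3, unchanged) -/

/-- **Geometric rigidity** (the group-theory-free half of (b′); Abrams–Gay–Kirby Thm 5 proof,
pp. 1541–1542, with Laudenbach–Poénaru replaced by `FillingUniqueness`): two closed connected
oriented smooth `4`-manifolds with balanced `(g, k)` Gay–Kirby trisections whose central surfaces
are related by a based, ambiently smooth homeomorphism `ψ` carrying each handlebody kernel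
`ker (π₁ F → π₁ Hᵢ)` onto the corresponding one are diffeomorphic. -/
def GeometricRigidity : Prop :=
  ∀ (X : Type) [TopologicalSpace X] [T2Space X] [SecondCountableTopology X]
    [ChartedSpace (EuclideanSpace ℝ (Fin 4)) X] [IsManifold (𝓡 4) ∞ X] [CompactSpace X]
    [ConnectedSpace X] (_ : SmoothOrientation (𝓡 4) X)
    (X' : Type) [TopologicalSpace X'] [T2Space X'] [SecondCountableTopology X']
    [ChartedSpace (EuclideanSpace ℝ (Fin 4)) X'] [IsManifold (𝓡 4) ∞ X'] [CompactSpace X']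
    [ConnectedSpace X'] (_ : SmoothOrientation (𝓡 4) X')
    (g k : ℕ) (S : Fin 3 → Set X) (S' : Fin 3 → Set X')
    (_ : IsBalancedGKTrisection X g k S) (_ : IsBalancedGKTrisection X' g k S')
    (x₀ : centralSurface S) (x₀' : centralSurface S')
    (ψ : centralSurface S ≃ₜ centralSurface S') (hψ : ψ x₀ = x₀'),
    AmbientSmooth S S' ψ → AmbientSmooth S' S ψ.symm →
    (∀ i : Fin 3, ((FundamentalGroup.map (centralInclusion S i) x₀).ker).map
        (FundamentalGroup.mapOfEq (⟨ψ, ψ.continuous⟩ : C(centralSurface S, centralSurface S')) hψ)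
        = (FundamentalGroup.map (centralInclusion S' i) x₀').ker) →
      Nonempty (X ≃ₘ⟮𝓡 4, 𝓡 4⟯ X')

/-- **Spine rigidity with cores** (r3): under the hypotheses of `GeometricRigidity` there are
smooth functions `f`, `f'` on `X`, `X'` with regular level `1/2` whose superlevel sets are
disjoint unions of three compact connected orientable `1`-handlebodies (cores of the sectors) and
whose sublevel sets (closed regular neighbourhoods of the spines) are DIFFEOMORPHIC. -/
def SpineRigidityWithCores : Prop :=
  ∀ (X : Type) [TopologicalSpace X] [T2Space X] [SecondCountableTopology X]
    [ChartedSpace (EuclideanSpace ℝ (Fin 4)) X] [IsManifold (𝓡 4) ∞ X] [CompactSpace X]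
    [ConnectedSpace X] (_ : SmoothOrientation (𝓡 4) X)
    (X' : Type) [TopologicalSpace X'] [T2Space X'] [SecondCountableTopology X']
    [ChartedSpace (EuclideanSpace ℝ (Fin 4)) X'] [IsManifold (𝓡 4) ∞ X'] [CompactSpace X']
    [ConnectedSpace X'] (_ : SmoothOrientation (𝓡 4) X')
    (g k : ℕ) (S : Fin 3 → Set X) (S' : Fin 3 → Set X')
    (_ : IsBalancedGKTrisection X g k S) (_ : IsBalancedGKTrisection X' g k S')
    (x₀ : centralSurface S) (x₀' : centralSurface S')
    (ψ : centralSurface S ≃ₜ centralSurface S') (hψ : ψ x₀ = x₀'),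
    AmbientSmooth S S' ψ → AmbientSmooth S' S ψ.symm →
    (∀ i : Fin 3, ((FundamentalGroup.map (centralInclusion S i) x₀).ker).map
        (FundamentalGroup.mapOfEq (⟨ψ, ψ.continuous⟩ : C(centralSurface S, centralSurface S')) hψ)
        = (FundamentalGroup.map (centralInclusion S' i) x₀').ker) →
    ∃ (f : X → ℝ) (f' : X' → ℝ) (hf : IsRegularLevel (𝓡 4) f (1 / 2))
      (hf' : IsRegularLevel (𝓡 4) f' (1 / 2))
      (V : Fin 3 → Type) (_ : ∀ i, TopologicalSpace (V i)) (_ : ∀ i, T2Space (V i))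
      (_ : ∀ i, SecondCountableTopology (V i)) (_ : ∀ i, CompactSpace (V i))
      (_ : ∀ i, ConnectedSpace (V i)) (_ : ∀ i, ChartedSpace (EuclideanHalfSpace 4) (V i))
      (_ : ∀ i, IsManifold (𝓡∂ 4) ∞ (V i))
      (_ : ∀ i, IsHandlebodyOfIndexLE 3 1 (V i)) (_ : ∀ i, IsOrientable (𝓡∂ 4) (V i))
      (V' : Fin 3 → Type) (_ : ∀ i, TopologicalSpace (V' i)) (_ : ∀ i, T2Space (V' i))
      (_ : ∀ i, SecondCountableTopology (V' i)) (_ : ∀ i, CompactSpace (V' i))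
      (_ : ∀ i, ConnectedSpace (V' i)) (_ : ∀ i, ChartedSpace (EuclideanHalfSpace 4) (V' i))
      (_ : ∀ i, IsManifold (𝓡∂ 4) ∞ (V' i))
      (_ : ∀ i, IsHandlebodyOfIndexLE 3 1 (V' i)) (_ : ∀ i, IsOrientable (𝓡∂ 4) (V' i))
      (_ : RegularSuperlevel hf ≃ₘ⟮𝓡∂ 4, 𝓡∂ 4⟯ (V 0 ⊕ (V 1 ⊕ V 2)))
      (_ : RegularSuperlevel hf' ≃ₘ⟮𝓡∂ 4, 𝓡∂ 4⟯ (V' 0 ⊕ (V' 1 ⊕ V' 2))),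
      Nonempty (RegularSublevel hf ≃ₘ⟮𝓡∂ 4, 𝓡∂ 4⟯ RegularSublevel hf')

/-! ## 2. The r5 statements: rigid sectors, zones, the spine germ, transport -/

/-- **Θ-standard data of a Gay–Kirby trisection** (r5, tree plumbing): one normal frame
`(u, v, ρ, U, O)` along `F = ⋂ S l` in which the three sectors are the three fixed linear wedges
(`TriNormalForm S 0 1 2`), and for each sector a corner-slice atlas over that frame (relabelled
coordinates for `S 1`, `S 2`) whose straightened structure on `↥(S m)` carries a handle
decomposition with one `0`-handle and `k m` `1`-handles, is compact and connected, and has as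
boundary points exactly the points lying in another sector.
(`IsGKTrisection.exists_triNormalForm`; `exists_cornerSliceAtlas_hasHandleDecomposition_of_ambient`
fed with `SectorNormalForm.corner/half/morse`; `HasHandleDecomposition.connectedSpace`;
`CornerSliceAtlas.isBoundaryPoint_iff_of_not_mem` + `HalfSliceChart.apply_zero_pos_iff_mem_interior`.) -/
def ThetaData : Prop :=
  ∀ (X : Type) [TopologicalSpace X] [T2Space X] [CompactSpace X]
    [ChartedSpace (EuclideanSpace ℝ (Fin 4)) X] [IsManifold (𝓡 4) ∞ X]
    (g : ℕ) (k : Fin 3 → ℕ) (S : Fin 3 → Set X) (_ : IsGKTrisection X g k S),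
    ∃ (u v : X → ℝ) (U O : Set X) (ρ : X → X)
      (Φ₀ : CornerSliceAtlas (S 0) (⋂ l, S l) u v ρ)
      (Φ₁ : CornerSliceAtlas (S 1) (⋂ l, S l) (fun y => v y - u y) (fun y => -u y) ρ)
      (Φ₂ : CornerSliceAtlas (S 2) (⋂ l, S l) (fun y => -v y) (fun y => u y - v y) ρ),
      TriNormalForm S 0 1 2 u v ρ U O (fun m => handleCount 1 (k m)) ∧
      (letI := Φ₀.chartedSpace
       HasHandleDecomposition 3 ↥(S 0) (handleCount 1 (k 0)) ∧ ConnectedSpace ↥(S 0) ∧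
        ∀ p : ↥(S 0), p ∈ (𝓡∂ 4).boundary ↥(S 0) ↔ ∃ j : Fin 3, j ≠ 0 ∧ p.1 ∈ S j) ∧
      (letI := Φ₁.chartedSpace
       HasHandleDecomposition 3 ↥(S 1) (handleCount 1 (k 1)) ∧ ConnectedSpace ↥(S 1) ∧
        ∀ p : ↥(S 1), p ∈ (𝓡∂ 4).boundary ↥(S 1) ↔ ∃ j : Fin 3, j ≠ 1 ∧ p.1 ∈ S j) ∧
      (letI := Φ₂.chartedSpace
       HasHandleDecomposition 3 ↥(S 2) (handleCount 1 (k 2)) ∧ ConnectedSpace ↥(S 2) ∧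
        ∀ p : ↥(S 2), p ∈ (𝓡∂ 4).boundary ↥(S 2) ↔ ∃ j : Fin 3, j ≠ 2 ∧ p.1 ∈ S j)

/-- **Tubular zone of a normal frame** (r5): for a normal frame `(u, v, ρ, U, O)` along a compact
`F` with corner-slice charts along `F`, there are an open `Z` with `F ⊆ Z ⊆ O`, a radius `r > 0`
and a map `A : X → ℝ × ℝ → X` (fibrewise translation of the normal coordinates) such that:
`u² + v² < r²` on `Z`; `(ρ, u, v)` is injective on `Z`; for `x ∈ Z` and `p` with
`(u x + p₁)² + (v x + p₂)² < r²` the point `A x p` lies in `Z` over the same point `ρ x` of `F` with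
normal coordinates `(u x + p₁, v x + p₂)` (so `Z ≅ F × D_r` through `(ρ, u, v)`); `A` is jointly
smooth there; and the sub-zones `{u² + v² < s²}` shrink to `F`.  (Finitely many corner-slice charts
cover `F`; in each, `A` is `y ↦ y + (p, 0, 0)`, chart-independent by `CornerSliceChart.trans_apply`;
injectivity for `r` small by a Lebesgue-number argument.) -/
def TubularZone : Prop :=
  ∀ (X : Type) [TopologicalSpace X] [T2Space X] [SecondCountableTopology X] [CompactSpace X]
    [ChartedSpace (EuclideanSpace ℝ (Fin 4)) X] [IsManifold (𝓡 4) ∞ X]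
    (Ssec F : Set X) (u v : X → ℝ) (ρ : X → X) (U O : Set X) (_ : NormalFrame F u v ρ U O)
    (_ : ∀ x ∈ F, ∃ C : CornerSliceChart Ssec F u v ρ, x ∈ C.Θ.source ∧ C.Θ.source ⊆ O),
    ∃ (Z : Set X) (r : ℝ) (A : X → ℝ × ℝ → X),
      IsOpen Z ∧ F ⊆ Z ∧ Z ⊆ O ∧ 0 < r ∧
      (∀ x ∈ Z, u x ^ 2 + v x ^ 2 < r ^ 2) ∧
      (∀ x ∈ Z, ∀ y ∈ Z, ρ x = ρ y → u x = u y → v x = v y → x = y) ∧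
      (∀ x ∈ Z, ∀ p : ℝ × ℝ, (u x + p.1) ^ 2 + (v x + p.2) ^ 2 < r ^ 2 →
        A x p ∈ Z ∧ ρ (A x p) = ρ x ∧ u (A x p) = u x + p.1 ∧ v (A x p) = v x + p.2) ∧
      ContMDiffOn ((𝓡 4).prod 𝓘(ℝ, ℝ × ℝ)) (𝓡 4) ∞ (fun q : X × (ℝ × ℝ) => A q.1 q.2)
        {q | q.1 ∈ Z ∧ (u q.1 + q.2.1) ^ 2 + (v q.1 + q.2.2) ^ 2 < r ^ 2} ∧
      (∀ V : Set X, IsOpen V → F ⊆ V →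
        ∃ s : ℝ, 0 < s ∧ ∀ x ∈ Z, u x ^ 2 + v x ^ 2 < s ^ 2 → x ∈ V)

/-- **The zone map** (r5): given tubular zones of normal frames along `F ⊆ X`, `F' ⊆ X'` and a
homeomorphism `ψ : F ≃ F'` which, together with its inverse, is the restriction of a smooth map
defined near `F` (resp. `F'`), the map `G x := A' (ψ (ρ x)) (u x, v x)` is, on a sub-zone
`{u² + v² < s²}`, a diffeomorphism onto the corresponding sub-zone of `X'` with inverse
`Ginv y := A (ψ⁻¹ (ρ' y)) (u' y, v' y)`; it preserves the normal coordinates, intertwines the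
retractions, and restricts to `ψ` on `F`. -/
def ZoneMap : Prop :=
  ∀ (X : Type) [TopologicalSpace X] [T2Space X] [SecondCountableTopology X] [CompactSpace X]
    [ChartedSpace (EuclideanSpace ℝ (Fin 4)) X] [IsManifold (𝓡 4) ∞ X]
    (X' : Type) [TopologicalSpace X'] [T2Space X'] [SecondCountableTopology X'] [CompactSpace X']
    [ChartedSpace (EuclideanSpace ℝ (Fin 4)) X'] [IsManifold (𝓡 4) ∞ X']
    (F : Set X) (u v : X → ℝ) (ρ : X → X) (U O : Set X) (_ : NormalFrame F u v ρ U O)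
    (F' : Set X') (u' v' : X' → ℝ) (ρ' : X' → X') (U' O' : Set X')
    (_ : NormalFrame F' u' v' ρ' U' O')
    -- tubular zone of the frame on `X`
    (Z : Set X) (r : ℝ) (A : X → ℝ × ℝ → X) (_ : IsOpen Z) (_ : F ⊆ Z) (_ : Z ⊆ O)
    (_ : 0 < r)
    (_ : ∀ x ∈ Z, u x ^ 2 + v x ^ 2 < r ^ 2)
    (_ : ∀ x ∈ Z, ∀ y ∈ Z, ρ x = ρ y → u x = u y → v x = v y → x = y)
    (_ : ∀ x ∈ Z, ∀ p : ℝ × ℝ, (u x + p.1) ^ 2 + (v x + p.2) ^ 2 < r ^ 2 →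
        A x p ∈ Z ∧ ρ (A x p) = ρ x ∧ u (A x p) = u x + p.1 ∧ v (A x p) = v x + p.2)
    (_ : ContMDiffOn ((𝓡 4).prod 𝓘(ℝ, ℝ × ℝ)) (𝓡 4) ∞ (fun q : X × (ℝ × ℝ) => A q.1 q.2)
        {q | q.1 ∈ Z ∧ (u q.1 + q.2.1) ^ 2 + (v q.1 + q.2.2) ^ 2 < r ^ 2})
    -- tubular zone of the frame on `X'`
    (Z' : Set X') (r' : ℝ) (A' : X' → ℝ × ℝ → X') (_ : IsOpen Z') (_ : F' ⊆ Z') (_ : Z' ⊆ O')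
    (_ : 0 < r')
    (_ : ∀ y ∈ Z', u' y ^ 2 + v' y ^ 2 < r' ^ 2)
    (_ : ∀ x ∈ Z', ∀ y ∈ Z', ρ' x = ρ' y → u' x = u' y → v' x = v' y → x = y)
    (_ : ∀ y ∈ Z', ∀ p : ℝ × ℝ, (u' y + p.1) ^ 2 + (v' y + p.2) ^ 2 < r' ^ 2 →
        A' y p ∈ Z' ∧ ρ' (A' y p) = ρ' y ∧ u' (A' y p) = u' y + p.1 ∧ v' (A' y p) = v' y + p.2)
    (_ : ContMDiffOn ((𝓡 4).prod 𝓘(ℝ, ℝ × ℝ)) (𝓡 4) ∞ (fun q : X' × (ℝ × ℝ) => A' q.1 q.2)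
        {q | q.1 ∈ Z' ∧ (u' q.1 + q.2.1) ^ 2 + (v' q.1 + q.2.2) ^ 2 < r' ^ 2})
    -- the ambiently smooth homeomorphism of the corner strata
    (ψ : ↥F ≃ₜ ↥F') (Uψ : Set X) (Ψ : X → X') (_ : IsOpen Uψ) (_ : F ⊆ Uψ)
    (_ : ContMDiffOn (𝓡 4) (𝓡 4) ∞ Ψ Uψ) (_ : ∀ (x : X) (hx : x ∈ F), Ψ x = (ψ ⟨x, hx⟩ : X'))
    (Uψ' : Set X') (Ψ' : X' → X) (_ : IsOpen Uψ') (_ : F' ⊆ Uψ')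
    (_ : ContMDiffOn (𝓡 4) (𝓡 4) ∞ Ψ' Uψ')
    (_ : ∀ (y : X') (hy : y ∈ F'), Ψ' y = (ψ.symm ⟨y, hy⟩ : X)),
    ∃ (G : X → X') (Ginv : X' → X) (s : ℝ), 0 < s ∧ s ≤ r ∧ s ≤ r' ∧
      (∀ x ∈ Z, u x ^ 2 + v x ^ 2 < s ^ 2 →
        G x ∈ Z' ∧ u' (G x) = u x ∧ v' (G x) = v x ∧ ρ' (G x) = G (ρ x) ∧ Ginv (G x) = x) ∧
      (∀ y ∈ Z', u' y ^ 2 + v' y ^ 2 < s ^ 2 →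
        Ginv y ∈ Z ∧ u (Ginv y) = u' y ∧ v (Ginv y) = v' y ∧ ρ (Ginv y) = Ginv (ρ' y) ∧
          G (Ginv y) = y) ∧
      (∀ (x : X) (hx : x ∈ F), G x = (ψ ⟨x, hx⟩ : X')) ∧
      (∀ (y : X') (hy : y ∈ F'), Ginv y = (ψ.symm ⟨y, hy⟩ : X)) ∧
      ContMDiffOn (𝓡 4) (𝓡 4) ∞ G {x | x ∈ Z ∧ u x ^ 2 + v x ^ 2 < s ^ 2} ∧
      ContMDiffOn (𝓡 4) (𝓡 4) ∞ Ginv {y | y ∈ Z' ∧ u' y ^ 2 + v' y ^ 2 < s ^ 2}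

/-- **Handlebody diffeomorphism matched to the zone map** (r5; Abrams–Gay–Kirby, proof of Thm 5,
"extend over the handlebodies", plus uniqueness of collars): in the setting of `ZoneMap`, let a
SEAM `Hs ⊇ F` of `X` and `Hs' ⊇ F'` of `X'` be, inside the zones, the rays
`{(u, v) = t (a, b), t ≥ 0}` of one direction `(a, b) ≠ 0`, and let `h : H → X`, `h' : H' → X'` be
smooth embeddings of compact connected `3`-dimensional handlebodies of genus `g` (clause (iii) of
`IsGKTrisection`) onto `Hs`, `Hs'` with `h(∂H) = F`, `h'(∂H') = F'`.  If `ψ = G|F` carries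
`ker (π₁ F → π₁ Hs)` onto `ker (π₁ F' → π₁ Hs')`, then `HandlebodyExtension` yields a
diffeomorphism `Ψ : H ≅ H'` which near `∂H` is the zone map: `h' ∘ Ψ = G ∘ h` on
`h⁻¹ {u² + v² < ε²}`.  (The boundary map induced by `G` is a diffeomorphism of the boundary data;
`HandlebodyExtension` gives `Ψ₀`; the collars `t ↦ h⁻¹ (A (h x) (t a, t b))` and their primed
version are matched with `Ψ₀ ∘ collar` by `BoundaryManifold.exists_diffeomorph_comp_collar_eq_collar`;
orientability of `H`, `H'` is supplied by the caller, `IsGKTrisection.isOrientable_of_clause_iii`.) -/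
def HandlebodyMatch : Prop :=
  ∀ (X : Type) [TopologicalSpace X] [T2Space X] [SecondCountableTopology X] [CompactSpace X]
    [ChartedSpace (EuclideanSpace ℝ (Fin 4)) X] [IsManifold (𝓡 4) ∞ X]
    (X' : Type) [TopologicalSpace X'] [T2Space X'] [SecondCountableTopology X'] [CompactSpace X']
    [ChartedSpace (EuclideanSpace ℝ (Fin 4)) X'] [IsManifold (𝓡 4) ∞ X']
    (F : Set X) (u v : X → ℝ) (ρ : X → X) (U O : Set X) (_ : NormalFrame F u v ρ U O)
    (F' : Set X') (u' v' : X' → ℝ) (ρ' : X' → X') (U' O' : Set X')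
    (_ : NormalFrame F' u' v' ρ' U' O')
    -- tubular zone of the frame on `X`
    (Z : Set X) (r : ℝ) (A : X → ℝ × ℝ → X) (_ : IsOpen Z) (_ : F ⊆ Z) (_ : Z ⊆ O)
    (_ : ∀ x ∈ Z, u x ^ 2 + v x ^ 2 < r ^ 2)
    (_ : ∀ x ∈ Z, ∀ y ∈ Z, ρ x = ρ y → u x = u y → v x = v y → x = y)
    (_ : ∀ x ∈ Z, ∀ p : ℝ × ℝ, (u x + p.1) ^ 2 + (v x + p.2) ^ 2 < r ^ 2 →
        A x p ∈ Z ∧ ρ (A x p) = ρ x ∧ u (A x p) = u x + p.1 ∧ v (A x p) = v x + p.2)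
    (_ : ContMDiffOn ((𝓡 4).prod 𝓘(ℝ, ℝ × ℝ)) (𝓡 4) ∞ (fun q : X × (ℝ × ℝ) => A q.1 q.2)
        {q | q.1 ∈ Z ∧ (u q.1 + q.2.1) ^ 2 + (v q.1 + q.2.2) ^ 2 < r ^ 2})
    -- tubular zone of the frame on `X'`
    (Z' : Set X') (r' : ℝ) (A' : X' → ℝ × ℝ → X') (_ : IsOpen Z') (_ : F' ⊆ Z') (_ : Z' ⊆ O')
    (_ : ∀ y ∈ Z', u' y ^ 2 + v' y ^ 2 < r' ^ 2)
    (_ : ∀ x ∈ Z', ∀ y ∈ Z', ρ' x = ρ' y → u' x = u' y → v' x = v' y → x = y)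
    (_ : ∀ y ∈ Z', ∀ p : ℝ × ℝ, (u' y + p.1) ^ 2 + (v' y + p.2) ^ 2 < r' ^ 2 →
        A' y p ∈ Z' ∧ ρ' (A' y p) = ρ' y ∧ u' (A' y p) = u' y + p.1 ∧ v' (A' y p) = v' y + p.2)
    (_ : ContMDiffOn ((𝓡 4).prod 𝓘(ℝ, ℝ × ℝ)) (𝓡 4) ∞ (fun q : X' × (ℝ × ℝ) => A' q.1 q.2)
        {q | q.1 ∈ Z' ∧ (u' q.1 + q.2.1) ^ 2 + (v' q.1 + q.2.2) ^ 2 < r' ^ 2})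
    -- the zone map
    (G : X → X') (Ginv : X' → X) (s : ℝ) (_ : 0 < s) (_ : s ≤ r) (_ : s ≤ r')
    (_ : ∀ x ∈ Z, u x ^ 2 + v x ^ 2 < s ^ 2 →
        G x ∈ Z' ∧ u' (G x) = u x ∧ v' (G x) = v x ∧ ρ' (G x) = G (ρ x) ∧ Ginv (G x) = x)
    (_ : ∀ y ∈ Z', u' y ^ 2 + v' y ^ 2 < s ^ 2 →
        Ginv y ∈ Z ∧ u (Ginv y) = u' y ∧ v (Ginv y) = v' y ∧ ρ (Ginv y) = Ginv (ρ' y) ∧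
          G (Ginv y) = y)
    (_ : ContMDiffOn (𝓡 4) (𝓡 4) ∞ G {x | x ∈ Z ∧ u x ^ 2 + v x ^ 2 < s ^ 2})
    (_ : ContMDiffOn (𝓡 4) (𝓡 4) ∞ Ginv {y | y ∈ Z' ∧ u' y ^ 2 + v' y ^ 2 < s ^ 2})
    -- the seam, a ray of direction `(a, b)` in the normal plane
    (a b : ℝ) (_ : a ≠ 0 ∨ b ≠ 0)
    (Hs : Set X) (hFH : F ⊆ Hs)
    (_ : ∀ x ∈ Z, x ∈ Hs ↔ ∃ t : ℝ, 0 ≤ t ∧ u x = t * a ∧ v x = t * b)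
    (Hs' : Set X') (hFH' : F' ⊆ Hs')
    (_ : ∀ y ∈ Z', y ∈ Hs' ↔ ∃ t : ℝ, 0 ≤ t ∧ u' y = t * a ∧ v' y = t * b)
    -- the abstract handlebodies of the seam (clause (iii) of `IsGKTrisection`)
    (g : ℕ) (H : Type) [TopologicalSpace H] [ChartedSpace (EuclideanHalfSpace 3) H]
    [IsManifold (𝓡∂ 3) ∞ H] [CompactSpace H] [ConnectedSpace H]
    (_ : HasHandleDecomposition 2 H (handleCount 1 g)) (_ : IsOrientable (𝓡∂ 3) H)
    (h : H → X) (_ : Manifold.IsSmoothEmbedding (𝓡∂ 3) (𝓡 4) ∞ h) (_ : range h = Hs)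
    (_ : h '' (𝓡∂ 3).boundary H = F)
    (H' : Type) [TopologicalSpace H'] [ChartedSpace (EuclideanHalfSpace 3) H']
    [IsManifold (𝓡∂ 3) ∞ H'] [CompactSpace H'] [ConnectedSpace H']
    (_ : HasHandleDecomposition 2 H' (handleCount 1 g)) (_ : IsOrientable (𝓡∂ 3) H')
    (h' : H' → X') (_ : Manifold.IsSmoothEmbedding (𝓡∂ 3) (𝓡 4) ∞ h') (_ : range h' = Hs')
    (_ : h' '' (𝓡∂ 3).boundary H' = F')
    -- `ψ = G|F` and the kernel condition
    (ψ : ↥F ≃ₜ ↥F') (_ : ∀ (x : X) (hx : x ∈ F), G x = (ψ ⟨x, hx⟩ : X'))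
    (x₀ : ↥F) (x₀' : ↥F') (hψ : ψ x₀ = x₀')
    (_ : ((FundamentalGroup.map
            (⟨Set.inclusion hFH, continuous_inclusion hFH⟩ : C(↥F, ↥Hs)) x₀).ker).map
          (FundamentalGroup.mapOfEq (⟨ψ, ψ.continuous⟩ : C(↥F, ↥F')) hψ)
        = (FundamentalGroup.map
            (⟨Set.inclusion hFH', continuous_inclusion hFH'⟩ : C(↥F', ↥Hs')) x₀').ker),
    HandlebodyExtension →
    ∃ (Ψ : H ≃ₘ⟮𝓡∂ 3, 𝓡∂ 3⟯ H') (ε : ℝ), 0 < ε ∧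
      ∀ z : H, h z ∈ Z → u (h z) ^ 2 + v (h z) ^ 2 < ε ^ 2 → h' (Ψ z) = G (h z)

/-- **The spine germ** (r5, the lead's stub; Abrams–Gay–Kirby, proof of Thm 5, "the spine has a
neighbourhood determined by the handlebodies"): for two trisections in normal form over frames
`(u, v, ρ)`, `(u', v', ρ')` with tubular zones and a zone map `G`, and for each of the three seams
`H_i = S (i+1) ∩ S (i+2)` (rays of directions `(-1,-1)`, `(1,0)`, `(0,1)`) a diffeomorphism `Ψ_i`
of its abstract handlebodies which is `G` near `∂H`, there is a diffeomorphism `G₀ : U₀ ≅ U₀'`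
between open neighbourhoods of the spines `⋃ H_i`, `⋃ H'_i`, carrying `S m ∩ U₀` onto
`S' m ∩ U₀'`, equal to `G` on a sub-zone `{u² + v² < s₀²}`.  (Bicollars of the seams which inside
the zone are the fibrewise translations `A`; `G₀ := G` on the zone and
`β' ∘ (Ψ_i × id) ∘ β⁻¹` along each seam; the pieces agree on overlaps; injectivity on a
neighbourhood of the spine from injectivity on the spine.) -/
def SpineGerm : Prop :=
  ∀ (X : Type) [TopologicalSpace X] [T2Space X] [SecondCountableTopology X] [CompactSpace X]
    [ChartedSpace (EuclideanSpace ℝ (Fin 4)) X] [IsManifold (𝓡 4) ∞ X]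
    (X' : Type) [TopologicalSpace X'] [T2Space X'] [SecondCountableTopology X'] [CompactSpace X']
    [ChartedSpace (EuclideanSpace ℝ (Fin 4)) X'] [IsManifold (𝓡 4) ∞ X']
    (S : Fin 3 → Set X) (S' : Fin 3 → Set X') (cnt cnt' : Fin 3 → ℕ → ℕ)
    (u v : X → ℝ) (ρ : X → X) (U O : Set X) (_ : TriNormalForm S 0 1 2 u v ρ U O cnt)
    (u' v' : X' → ℝ) (ρ' : X' → X') (U' O' : Set X')
    (_ : TriNormalForm S' 0 1 2 u' v' ρ' U' O' cnt')
    -- tubular zone of the frame on `X` (`F = ⋂ S l`)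
    (Z : Set X) (r : ℝ) (A : X → ℝ × ℝ → X) (_ : IsOpen Z) (_ : (⋂ l, S l) ⊆ Z) (_ : Z ⊆ O)
    (_ : ∀ x ∈ Z, u x ^ 2 + v x ^ 2 < r ^ 2)
    (_ : ∀ x ∈ Z, ∀ y ∈ Z, ρ x = ρ y → u x = u y → v x = v y → x = y)
    (_ : ∀ x ∈ Z, ∀ p : ℝ × ℝ, (u x + p.1) ^ 2 + (v x + p.2) ^ 2 < r ^ 2 →
        A x p ∈ Z ∧ ρ (A x p) = ρ x ∧ u (A x p) = u x + p.1 ∧ v (A x p) = v x + p.2)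
    (_ : ContMDiffOn ((𝓡 4).prod 𝓘(ℝ, ℝ × ℝ)) (𝓡 4) ∞ (fun q : X × (ℝ × ℝ) => A q.1 q.2)
        {q | q.1 ∈ Z ∧ (u q.1 + q.2.1) ^ 2 + (v q.1 + q.2.2) ^ 2 < r ^ 2})
    (_ : ∀ V : Set X, IsOpen V → (⋂ l, S l) ⊆ V →
        ∃ s : ℝ, 0 < s ∧ ∀ x ∈ Z, u x ^ 2 + v x ^ 2 < s ^ 2 → x ∈ V)
    -- tubular zone of the frame on `X'`
    (Z' : Set X') (r' : ℝ) (A' : X' → ℝ × ℝ → X') (_ : IsOpen Z') (_ : (⋂ l, S' l) ⊆ Z')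
    (_ : Z' ⊆ O')
    (_ : ∀ y ∈ Z', u' y ^ 2 + v' y ^ 2 < r' ^ 2)
    (_ : ∀ x ∈ Z', ∀ y ∈ Z', ρ' x = ρ' y → u' x = u' y → v' x = v' y → x = y)
    (_ : ∀ y ∈ Z', ∀ p : ℝ × ℝ, (u' y + p.1) ^ 2 + (v' y + p.2) ^ 2 < r' ^ 2 →
        A' y p ∈ Z' ∧ ρ' (A' y p) = ρ' y ∧ u' (A' y p) = u' y + p.1 ∧ v' (A' y p) = v' y + p.2)
    (_ : ContMDiffOn ((𝓡 4).prod 𝓘(ℝ, ℝ × ℝ)) (𝓡 4) ∞ (fun q : X' × (ℝ × ℝ) => A' q.1 q.2)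
        {q | q.1 ∈ Z' ∧ (u' q.1 + q.2.1) ^ 2 + (v' q.1 + q.2.2) ^ 2 < r' ^ 2})
    (_ : ∀ V : Set X', IsOpen V → (⋂ l, S' l) ⊆ V →
        ∃ s : ℝ, 0 < s ∧ ∀ y ∈ Z', u' y ^ 2 + v' y ^ 2 < s ^ 2 → y ∈ V)
    -- the zone map
    (G : X → X') (Ginv : X' → X) (s : ℝ) (_ : 0 < s) (_ : s ≤ r) (_ : s ≤ r')
    (_ : ∀ x ∈ Z, u x ^ 2 + v x ^ 2 < s ^ 2 →
        G x ∈ Z' ∧ u' (G x) = u x ∧ v' (G x) = v x ∧ ρ' (G x) = G (ρ x) ∧ Ginv (G x) = x)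
    (_ : ∀ y ∈ Z', u' y ^ 2 + v' y ^ 2 < s ^ 2 →
        Ginv y ∈ Z ∧ u (Ginv y) = u' y ∧ v (Ginv y) = v' y ∧ ρ (Ginv y) = Ginv (ρ' y) ∧
          G (Ginv y) = y)
    (_ : ∀ x ∈ (⋂ l, S l), G x ∈ ⋂ l, S' l) (_ : ∀ y ∈ (⋂ l, S' l), Ginv y ∈ ⋂ l, S l)
    (_ : ContMDiffOn (𝓡 4) (𝓡 4) ∞ G {x | x ∈ Z ∧ u x ^ 2 + v x ^ 2 < s ^ 2})
    (_ : ContMDiffOn (𝓡 4) (𝓡 4) ∞ Ginv {y | y ∈ Z' ∧ u' y ^ 2 + v' y ^ 2 < s ^ 2})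
    -- the matched handlebody diffeomorphisms of the three seams `S (i+1) ∩ S (i+2)`
    (Hd : Fin 3 → Type) (_ : ∀ i, TopologicalSpace (Hd i))
    (_ : ∀ i, ChartedSpace (EuclideanHalfSpace 3) (Hd i)) (_ : ∀ i, IsManifold (𝓡∂ 3) ∞ (Hd i))
    (_ : ∀ i, CompactSpace (Hd i))
    (hh : ∀ i, Hd i → X) (_ : ∀ i, Manifold.IsSmoothEmbedding (𝓡∂ 3) (𝓡 4) ∞ (hh i))
    (_ : ∀ i, range (hh i) = S (i + 1) ∩ S (i + 2))
    (_ : ∀ i, hh i '' (𝓡∂ 3).boundary (Hd i) = ⋂ l, S l)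
    (Hd' : Fin 3 → Type) (_ : ∀ i, TopologicalSpace (Hd' i))
    (_ : ∀ i, ChartedSpace (EuclideanHalfSpace 3) (Hd' i)) (_ : ∀ i, IsManifold (𝓡∂ 3) ∞ (Hd' i))
    (_ : ∀ i, CompactSpace (Hd' i))
    (hh' : ∀ i, Hd' i → X') (_ : ∀ i, Manifold.IsSmoothEmbedding (𝓡∂ 3) (𝓡 4) ∞ (hh' i))
    (_ : ∀ i, range (hh' i) = S' (i + 1) ∩ S' (i + 2))
    (_ : ∀ i, hh' i '' (𝓡∂ 3).boundary (Hd' i) = ⋂ l, S' l)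
    (Ψ : ∀ i, Hd i ≃ₘ⟮𝓡∂ 3, 𝓡∂ 3⟯ Hd' i) (ε : ℝ) (_ : 0 < ε)
    (_ : ∀ i (z : Hd i), hh i z ∈ Z → u (hh i z) ^ 2 + v (hh i z) ^ 2 < ε ^ 2 →
        hh' i (Ψ i z) = G (hh i z)),
    ∃ (U₀ : Set X) (U₀' : Set X') (G₀ : X → X') (G₀inv : X' → X) (s₀ : ℝ),
      IsOpen U₀ ∧ IsOpen U₀' ∧ (∀ i j, i ≠ j → S i ∩ S j ⊆ U₀) ∧ (∀ i j, i ≠ j → S' i ∩ S' j ⊆ U₀') ∧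
      MapsTo G₀ U₀ U₀' ∧ MapsTo G₀inv U₀' U₀ ∧ (∀ x ∈ U₀, G₀inv (G₀ x) = x) ∧
      (∀ y ∈ U₀', G₀ (G₀inv y) = y) ∧
      ContMDiffOn (𝓡 4) (𝓡 4) ∞ G₀ U₀ ∧ ContMDiffOn (𝓡 4) (𝓡 4) ∞ G₀inv U₀' ∧
      (∀ m, ∀ x ∈ U₀, x ∈ S m ↔ G₀ x ∈ S' m) ∧
      0 < s₀ ∧ s₀ ≤ s ∧
      (∀ x ∈ Z, u x ^ 2 + v x ^ 2 < s₀ ^ 2 → x ∈ U₀ ∧ G₀ x = G x) ∧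
      (∀ y ∈ Z', u' y ^ 2 + v' y ^ 2 < s₀ ^ 2 → y ∈ U₀' ∧ G₀inv y = Ginv y)

/-- **Standard cores for prescribed sector data** (r5 Step A; the landed `stub_sectorCores`
construction re-run for GIVEN clause-(ii) data, given boundary data and a thinness constraint): for
a closed oriented `4`-manifold covered by three closed sets `S m` presented by clause-(ii) data
`eₘ : Wₘ → X` (compact connected `4`-manifolds with boundary with one `0`-handle and `k`
`1`-handles), boundary data `bₘ` and an open `V₀` containing the spine `⋃_{i≠j} S i ∩ S j`, there
are collars `cₘ` of `bₘ` whose images under `eₘ` lie in `V₀` and a smooth `f` with regular level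
`1/2`, reading `coreProfile` in every collar coordinate, with `{f ≤ 1/2} = ⋃ₘ eₘ(cₘ(∂Wₘ × [0,1/2]))`
and `{f ≥ 1/2}` diffeomorphic to a disjoint union of three compact connected orientable
`1`-handlebodies.  (Flow-out collar adapted to the Morse function of `Wₘ`, of height small enough
for `V₀` — `SectorLevelData`; `core_package`; `nonempty_diffeomorph_of_partition`; orientations
pulled back from `X`.) -/
def StandardCores : Prop :=
  ∀ (X : Type) [TopologicalSpace X] [T2Space X] [SecondCountableTopology X]
    [ChartedSpace (EuclideanSpace ℝ (Fin 4)) X] [IsManifold (𝓡 4) ∞ X] [CompactSpace X]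
    [ConnectedSpace X] (_ : SmoothOrientation (𝓡 4) X)
    (k : ℕ) (S : Fin 3 → Set X) (_ : (⋃ i, S i) = univ)
    (W : Fin 3 → Type) (_ : ∀ i, TopologicalSpace (W i)) (_ : ∀ i, T2Space (W i))
    (_ : ∀ i, SecondCountableTopology (W i)) (_ : ∀ i, CompactSpace (W i))
    (_ : ∀ i, ConnectedSpace (W i)) (_ : ∀ i, ChartedSpace (EuclideanHalfSpace 4) (W i))
    (_ : ∀ i, IsManifold (𝓡∂ 4) ∞ (W i))
    (_ : ∀ i, HasHandleDecomposition 3 (W i) (handleCount 1 k))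
    (e : ∀ i, W i → X) (_ : ∀ i, Topology.IsEmbedding (e i)) (_ : ∀ i, range (e i) = S i)
    (_ : ∀ i w, e i w ∉ (⋂ l, S l) → Manifold.IsImmersionAt (𝓡∂ 4) (𝓡 4) ∞ (e i) w)
    (_ : ∀ i w, e i w ∈ (⋂ l, S l) → IsCornerAt (e i) w)
    (_ : ∀ i j, j ≠ i → S i ∩ S j ⊆ e i '' (𝓡∂ 4).boundary (W i))
    (b : ∀ i, BoundaryData (𝓡∂ 4) (W i) (𝓡 3))
    (V₀ : Set X) (_ : IsOpen V₀) (_ : ∀ i j, i ≠ j → S i ∩ S j ⊆ V₀),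
    ∃ (c : ∀ i, (b i).OpenCollarData) (f : X → ℝ) (hf : IsRegularLevel (𝓡 4) f (1 / 2))
      (V : Fin 3 → Type) (_ : ∀ i, TopologicalSpace (V i)) (_ : ∀ i, T2Space (V i))
      (_ : ∀ i, SecondCountableTopology (V i)) (_ : ∀ i, CompactSpace (V i))
      (_ : ∀ i, ConnectedSpace (V i)) (_ : ∀ i, ChartedSpace (EuclideanHalfSpace 4) (V i))
      (_ : ∀ i, IsManifold (𝓡∂ 4) ∞ (V i))
      (_ : ∀ i, IsHandlebodyOfIndexLE 3 1 (V i)) (_ : ∀ i, IsOrientable (𝓡∂ 4) (V i))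
      (_ : RegularSuperlevel hf ≃ₘ⟮𝓡∂ 4, 𝓡∂ 4⟯ (V 0 ⊕ (V 1 ⊕ V 2))),
      (∀ i (x : (b i).carrier), ∀ t ∈ Set.Ico 0 (c i).top, e i ((c i).toFun x t) ∈ V₀) ∧
      f ⁻¹' Set.Iic (1 / 2) =
          ⋃ i, (fun p : (b i).carrier × Set.Icc (0 : ℝ) 1 => e i ((c i).collarMap p)) ''
            {p | (p.2 : ℝ) ≤ 1 / 2} ∧
      ∀ i (x : (b i).carrier) (t : Set.Icc (0 : ℝ) 1), f (e i ((c i).collarMap (x, t))) = coreProfile t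

/-- **Transport of boundary data and thin collars along the spine germ** (r5): let `Φ`, `Φ'` be
corner-slice atlases of sectors `S ⊆ X`, `S' ⊆ X'` with corner loci `K`, `K'` over frames
`(u, v, π)`, `(u', v', π')`, and `G₀ : U₀ ≅ U₀'` a diffeomorphism of open sets carrying `S ∩ U₀`
onto `S' ∩ U₀'` and `K ∩ U₀` onto `K' ∩ U₀'`, which on an open `π`-stable `Zc ⊇ K` preserves
`(u, v)` and intertwines `π`, `π'`.  Then `G₀` is smooth for the straightened structures
(`Φ.chartedSpace`, `Φ'.chartedSpace`; at corner points by the rigid form of the corner/corner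
transition, `CornerSliceChart.fold_trans_apply` with `G₀` inserted; elsewhere through half-slice
charts), so if the boundary of `↥S` lies over `U₀`, every boundary datum `b` of `↥S` and every
open collar `c` of `b` with region over `U₀` are transported: there are a boundary datum `b'` of
`↥S'`, an open collar `c'` of `b'` of the same height and a bijection `φ` of the carriers with
`c' (φ x) t = G₀ (c x t)` for `0 ≤ t < c.top`. -/
def CollarTransport : Prop :=
  ∀ (X : Type) [TopologicalSpace X] [T2Space X] [SecondCountableTopology X]
    [ChartedSpace (EuclideanSpace ℝ (Fin 4)) X] [IsManifold (𝓡 4) ∞ X]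
    (X' : Type) [TopologicalSpace X'] [T2Space X'] [SecondCountableTopology X']
    [ChartedSpace (EuclideanSpace ℝ (Fin 4)) X'] [IsManifold (𝓡 4) ∞ X']
    (S K : Set X) (_ : IsCompact S) (u v : X → ℝ) (π : X → X) (Φ : CornerSliceAtlas S K u v π)
    (S' K' : Set X') (_ : IsCompact S') (u' v' : X' → ℝ) (π' : X' → X')
    (Φ' : CornerSliceAtlas S' K' u' v' π')
    (U₀ : Set X) (U₀' : Set X') (G₀ : X → X') (G₀inv : X' → X) (_ : IsOpen U₀) (_ : IsOpen U₀')
    (_ : MapsTo G₀ U₀ U₀') (_ : MapsTo G₀inv U₀' U₀) (_ : ∀ x ∈ U₀, G₀inv (G₀ x) = x)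
    (_ : ∀ y ∈ U₀', G₀ (G₀inv y) = y)
    (_ : ContMDiffOn (𝓡 4) (𝓡 4) ∞ G₀ U₀) (_ : ContMDiffOn (𝓡 4) (𝓡 4) ∞ G₀inv U₀')
    (_ : ∀ x ∈ U₀, x ∈ S ↔ G₀ x ∈ S') (_ : ∀ x ∈ U₀, x ∈ K ↔ G₀ x ∈ K')
    (Zc : Set X) (_ : IsOpen Zc) (_ : K ⊆ Zc) (_ : Zc ⊆ U₀) (_ : ∀ x ∈ Zc, π x ∈ Zc)
    (_ : ∀ x ∈ Zc, u' (G₀ x) = u x) (_ : ∀ x ∈ Zc, v' (G₀ x) = v x)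
    (_ : ∀ x ∈ Zc, π' (G₀ x) = G₀ (π x))
    (_ : letI := Φ.chartedSpace; ∀ p : ↥S, p ∈ (𝓡∂ 4).boundary ↥S → p.1 ∈ U₀)
    (b : letI := Φ.chartedSpace; BoundaryData (𝓡∂ 4) ↥S (𝓡 3))
    (c : letI := Φ.chartedSpace; b.OpenCollarData)
    (_ : letI := Φ.chartedSpace; ∀ (x : b.carrier), ∀ t ∈ Set.Ico 0 c.top, (c.toFun x t).1 ∈ U₀),
    letI := Φ.chartedSpace
    letI := Φ'.chartedSpace
    ∃ (b' : BoundaryData (𝓡∂ 4) ↥S' (𝓡 3)) (c' : b'.OpenCollarData) (φ : b.carrier ≃ b'.carrier),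
      c'.top = c.top ∧
      ∀ (x : b.carrier), ∀ t ∈ Set.Ico 0 c.top, (c'.toFun (φ x) t).1 = G₀ (c.toFun x t).1

/-- **Core independence** (r5; previously the lead's target (P5), `PrismRigidityTargets.lean`): for
a compact smooth `(n+2)`-manifold with boundary `W`, a boundary datum `b`, two open collars
`c, ĉ` of `b` (`BoundaryData.OpenCollarData`: collar map with smooth height and projection) and
two levels `a, â ∈ (0, 1)`, there is a self-diffeomorphism `Φ` of `W`, equal to the identity off a
compact subset of the interior, carrying the open collar end `c(∂W × [0, a))` onto
`ĉ(∂W × [0, â))`.  (The `ĉ`-height increases strictly along the `c`-lines near `∂W` (both collars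
enter the interior transversally), so for `â` small — reached first by pushing down along the
regular function `ĉ.height` — the function `θ = λ(t)·K t + (1 - λ(t))·(ĉ.height)` of the
`c`-coordinates `(x, t)` has `∂ₜθ > 0`, `{θ < â} = ĉ(∂W × [0, â))` and `{θ < K a} = c(∂W × [0, a))`;
push down along the regular interval `[â, K a]` of `θ` by a flow compactly supported in the
interior.) -/
def CoreIndependence : Prop :=
  ∀ (n : ℕ) (W : Type) [TopologicalSpace W] [T2Space W] [SecondCountableTopology W]
    [CompactSpace W] [ChartedSpace (EuclideanHalfSpace (n + 2)) W] [IsManifold (𝓡∂ (n + 2)) ∞ W]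
    (b : BoundaryData (𝓡∂ (n + 2)) W (𝓡 (n + 1))) (c ĉ : b.OpenCollarData) (a â : ℝ),
    0 < a → a < 1 → 0 < â → â < 1 →
    ∃ Φ : W ≃ₘ⟮𝓡∂ (n + 2), 𝓡∂ (n + 2)⟯ W,
      (∃ K : Set W, IsCompact K ∧ K ⊆ (𝓡∂ (n + 2)).interior W ∧ ∀ w, w ∉ K → Φ w = w) ∧
      Φ '' (c.collarMap '' {p | (p.2 : ℝ) < a}) = ĉ.collarMap '' {p | (p.2 : ℝ) < â}

/-- **Prism independence** (r5): for three closed sets `S m ⊆ X` presented by embeddings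
`eₘ : Wₘ → X` of compact `4`-manifolds with boundary which are immersions at interior points and
put `S i ∩ S j` on the boundary, and for two families of open collars `cₘ`, `ĉₘ` of the same
boundary data, some self-diffeomorphism of `X` carries the prism neighbourhood
`⋃ₘ eₘ(cₘ(∂Wₘ × [0, 1/2]))` onto `⋃ₘ eₘ(ĉₘ(∂Wₘ × [0, 1/2]))`.  (`CoreIndependence` in each `Wₘ`,
extended by the identity through `eₘ` on the open interiors `eₘ(Wₘ°)`, which are pairwise disjoint
and avoid the spine; closures of the open collar ends are the closed ones.) -/
def PrismIndependence : Prop :=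
  ∀ (X : Type) [TopologicalSpace X] [T2Space X] [SecondCountableTopology X]
    [ChartedSpace (EuclideanSpace ℝ (Fin 4)) X] [IsManifold (𝓡 4) ∞ X]
    (S : Fin 3 → Set X)
    (W : Fin 3 → Type) (_ : ∀ i, TopologicalSpace (W i)) (_ : ∀ i, T2Space (W i))
    (_ : ∀ i, SecondCountableTopology (W i)) (_ : ∀ i, CompactSpace (W i))
    (_ : ∀ i, ChartedSpace (EuclideanHalfSpace 4) (W i)) (_ : ∀ i, IsManifold (𝓡∂ 4) ∞ (W i))
    (e : ∀ i, W i → X) (_ : ∀ i, Topology.IsEmbedding (e i)) (_ : ∀ i, range (e i) = S i)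
    (_ : ∀ i w, (𝓡∂ 4).IsInteriorPoint w → Manifold.IsImmersionAt (𝓡∂ 4) (𝓡 4) ∞ (e i) w)
    (_ : ∀ i j, j ≠ i → S i ∩ S j ⊆ e i '' (𝓡∂ 4).boundary (W i))
    (b : ∀ i, BoundaryData (𝓡∂ 4) (W i) (𝓡 3)) (c ĉ : ∀ i, (b i).OpenCollarData),
    CoreIndependence →
    ∃ Φ : X ≃ₘ⟮𝓡 4, 𝓡 4⟯ X,
      Φ '' (⋃ i, (fun p : (b i).carrier × Set.Icc (0 : ℝ) 1 => e i ((c i).collarMap p)) ''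
          {p | (p.2 : ℝ) ≤ 1 / 2}) =
        ⋃ i, (fun p : (b i).carrier × Set.Icc (0 : ℝ) 1 => e i ((ĉ i).collarMap p)) ''
          {p | (p.2 : ℝ) ≤ 1 / 2}

/-- **Sublevel transfer** (r5): a partial diffeomorphism `G₀ : U₀ ≅ U₀'` defined around a regular
sublevel set `{f ≤ a} ⊆ U₀` and carrying it onto a regular sublevel set `{f' ≤ a'}` induces a
diffeomorphism of the `RegularSublevel` manifolds with boundary (smoothness into a regular domain
is tested in the ambient manifold, `HalfSliceAtlas.contMDiff_codRestrict`). -/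
def SublevelTransfer : Prop :=
  ∀ (X : Type) [TopologicalSpace X] [T2Space X] [SecondCountableTopology X]
    [ChartedSpace (EuclideanSpace ℝ (Fin 4)) X] [IsManifold (𝓡 4) ∞ X]
    (X' : Type) [TopologicalSpace X'] [T2Space X'] [SecondCountableTopology X']
    [ChartedSpace (EuclideanSpace ℝ (Fin 4)) X'] [IsManifold (𝓡 4) ∞ X']
    (f : X → ℝ) (f' : X' → ℝ) (a a' : ℝ) (hf : IsRegularLevel (𝓡 4) f a)
    (hf' : IsRegularLevel (𝓡 4) f' a')
    (U₀ : Set X) (U₀' : Set X') (G₀ : X → X') (G₀inv : X' → X), IsOpen U₀ → IsOpen U₀' →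
    MapsTo G₀ U₀ U₀' → MapsTo G₀inv U₀' U₀ → (∀ x ∈ U₀, G₀inv (G₀ x) = x) →
    (∀ y ∈ U₀', G₀ (G₀inv y) = y) →
    ContMDiffOn (𝓡 4) (𝓡 4) ∞ G₀ U₀ → ContMDiffOn (𝓡 4) (𝓡 4) ∞ G₀inv U₀' →
    f ⁻¹' Set.Iic a ⊆ U₀ → G₀ '' (f ⁻¹' Set.Iic a) = f' ⁻¹' Set.Iic a' →
    Nonempty (RegularSublevel hf ≃ₘ⟮𝓡∂ 4, 𝓡∂ 4⟯ RegularSublevel hf')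

/-! ## 3. Registered stubs -/

/-- **stub — Laudenbach–Poénaru** (tree named fact `exists_diffeomorph_comp_incl_eq`; DELEGATED to
its fact seat). -/
theorem stub_laudenbachPoenaru : exists_diffeomorph_comp_incl_eq.{0} := by
  sorry

/-- **stub — Griffiths' theorem** (DELEGATED Literature named fact `GriffithsExtension`, p90855). -/
theorem stub_griffiths : GriffithsExtension := by
  sorry

/-- **stub — smooth based Dehn–Nielsen–Baer on `∂H_g`** (DELEGATED Literature named fact
`DehnNielsenBaerSurfaceSmooth`, p94066). -/
theorem stub_dnbSurface : DehnNielsenBaerSurfaceSmooth := by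
  sorry

/-- **stub — (c′) stabilisation compatibility** (tree named fact `exists_stabilized_gkTrisection`;
DELEGATED, in flight). -/
theorem stub_stabilization : exists_stabilized_gkTrisection.{0} := by
  sorry

/-- **stub — Θ-standard data** (r5). -/
theorem stub_thetaData : ThetaData := by
  sorry

/-- **stub — tubular zone** (r5). -/
theorem stub_tubularZone : TubularZone := by
  sorry

/-- **stub — zone map** (r5). -/
theorem stub_zoneMap : ZoneMap := by
  sorry

/-- **stub — handlebody match** (r5). -/
theorem stub_handlebodyMatch : HandlebodyMatch := by
  sorry

/-- **stub — spine germ** (r5, lead). -/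
theorem stub_spineGerm : SpineGerm := by
  sorry

/-- **stub — standard cores** (r5). -/
theorem stub_standardCores : StandardCores := by
  sorry

/-- **stub — collar transport** (r5). -/
theorem stub_collarTransport : CollarTransport := by
  sorry

/-- **stub — core independence** (r5). -/
theorem stub_coreIndependence : CoreIndependence := by
  sorry

/-- **stub — prism independence** (r5). -/
theorem stub_prismIndependence : PrismIndependence := by
  sorry

/-- **stub — sublevel transfer** (r5). -/
theorem stub_sublevelTransfer : SublevelTransfer := by
  sorry

/-- **stub — the spine assembly** (r5, lead): `SpineRigidityWithCores` from the nine r5 statements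
and `HandlebodyExtension` (frames and Θ-data on both sides, zones, zone map from the ambiently smooth
`ψ`, matched handlebody diffeomorphisms from the kernel condition, the spine germ, thin standard
cores on `X`, transported collars and standard cores on `X'`, prism independence on `X'`, sublevel
transfer).  Registered as a stub so that the line's workers can start; proved by the lead in this
file family. -/
theorem stub_spineAssembly :
    ThetaData → TubularZone → ZoneMap → HandlebodyMatch → SpineGerm → StandardCores →
    CollarTransport → CoreIndependence → PrismIndependence → SublevelTransfer →
    HandlebodyExtension → SpineRigidityWithCores := by
  sorry

/-! ## 4. Proved glue (r3, landed pieces imported) -/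

/-- **Geometric rigidity from spine rigidity and cored reassembly** (r3, proved glue). -/
theorem geometricRigidity_of_spine_of_cored
    (hSR : HandlebodyExtension → SpineRigidityWithCores)
    (hCR : FillingUniqueness → CoredReassembly) :
    FillingUniqueness → HandlebodyExtension → GeometricRigidity := by
  intro hFU hHE X _ _ _ _ _ _ _ o X' _ _ _ _ _ _ _ o' g k S S' h h' x₀ x₀' ψ hψ hs hs' hker
  obtain ⟨f, f', hf, hf', V, i₁, i₂, i₃, i₄, i₅, i₆, i₇, hV, hVo, V', j₁, j₂, j₃, j₄, j₅, j₆, j₇,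
    hV', hVo', eV, eV', ⟨Θ⟩⟩ := hSR hHE X o X' o' g k S S' h h' x₀ x₀' ψ hψ hs hs' hker
  exact hCR hFU X o X' o' f f' hf hf' V i₁ i₂ i₃ i₄ i₅ i₆ i₇ hV hVo V' j₁ j₂ j₃ j₄ j₅ j₆ j₇ hV'
    hVo' eV eV' Θ

section Bookkeeping

variable {A B : Type*} [Group A] [Group B]

/-- `comap` along a group isomorphism is `map` along its inverse. -/
theorem comap_mulEquiv_eq_map_symm (e : A ≃* B) (K : Subgroup B) :
    K.comap e.toMonoidHom = K.map e.symm.toMonoidHom := by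
  ext x
  simp only [Subgroup.mem_comap, MulEquiv.coe_toMonoidHom, Subgroup.mem_map]
  constructor
  · intro hx
    exact ⟨e x, hx, by simp⟩
  · rintro ⟨y, hy, rfl⟩
    simpa using hy

/-- `map` along a group isomorphism followed by `map` along its inverse is the identity. -/
theorem map_map_symm (e : A ≃* B) (K : Subgroup B) :
    (K.map e.symm.toMonoidHom).map e.toMonoidHom = K := by
  rw [Subgroup.map_map]
  have : e.toMonoidHom.comp e.symm.toMonoidHom = MonoidHom.id B := MonoidHom.ext fun x => by simp
  rw [this, Subgroup.map_id]

end Bookkeeping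

/-- **(b′) from geometric rigidity and Dehn–Nielsen–Baer** — the marking bookkeeping (r1, proved). -/
theorem rigidity_of_geometricRigidity_of_dnb (hgeo : GeometricRigidity)
    (hdnb : DehnNielsenBaerCentral) : diffeomorph_of_iso_groupGKTrisectionOf.{0} := by
  intro X _ _ _ _ _ _ _ o X' _ _ _ _ _ _ _ o' g k S S' h h' x₀ x₀' μ μ' hiso
  obtain ⟨α, hα⟩ := hiso
  let θ : FundamentalGroup (centralSurface S) x₀ ≃* FundamentalGroup (centralSurface S') x₀' :=
    μ.symm.trans (α.trans μ')
  obtain ⟨ψ, hψ, hs, hs', hind⟩ := hdnb X o X' o' g k S S' h h' x₀ x₀' μ θ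
  refine hgeo X o X' o' g k S S' h h' x₀ x₀' ψ hψ hs hs' fun i => ?_
  have hψθ : (FundamentalGroup.mapOfEq (⟨ψ, ψ.continuous⟩ : C(centralSurface S, centralSurface S')) hψ)
      = θ.toMonoidHom := MonoidHom.ext fun γ => hind γ
  rw [hψθ]
  have hKi : (FundamentalGroup.map (centralInclusion S i) x₀).ker
      = (groupGKTrisectionOf h x₀ μ i).map μ.toMonoidHom := by
    show _ = (((FundamentalGroup.map (centralInclusion S i) x₀).ker).comap μ.toMonoidHom).map μ.toMonoidHom
    rw [comap_mulEquiv_eq_map_symm, map_map_symm]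
  have hcomp : θ.toMonoidHom.comp μ.toMonoidHom = μ'.toMonoidHom.comp α.toMonoidHom :=
    MonoidHom.ext fun x => by simp [θ]
  calc ((FundamentalGroup.map (centralInclusion S i) x₀).ker).map θ.toMonoidHom
      = ((groupGKTrisectionOf h x₀ μ i).map μ.toMonoidHom).map θ.toMonoidHom := by rw [hKi]
    _ = (groupGKTrisectionOf h x₀ μ i).map (θ.toMonoidHom.comp μ.toMonoidHom) := by
        rw [Subgroup.map_map]
    _ = (groupGKTrisectionOf h x₀ μ i).map (μ'.toMonoidHom.comp α.toMonoidHom) := by rw [hcomp]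
    _ = ((groupGKTrisectionOf h x₀ μ i).map α.toMonoidHom).map μ'.toMonoidHom := by
        rw [Subgroup.map_map]
    _ = (groupGKTrisectionOf h' x₀' μ' i).map μ'.toMonoidHom := by rw [hα i]
    _ = (FundamentalGroup.map (centralInclusion S' i) x₀').ker := by
        show ((((FundamentalGroup.map (centralInclusion S' i) x₀').ker).comap μ'.toMonoidHom).map
          μ'.toMonoidHom) = _
        rw [comap_mulEquiv_eq_map_symm, map_map_symm]

/-! ## 5. The composition -/

/-- **The crux (its body) from the fifteen stub STATEMENTS** — kernel-checked, sorry-free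
composition (r5).  Hypotheses, in order: the statements of `stub_laudenbachPoenaru`,
`stub_griffiths`, `stub_dnbSurface`, `stub_thetaData`, `stub_tubularZone`, `stub_zoneMap`,
`stub_handlebodyMatch`, `stub_spineGerm`, `stub_standardCores`, `stub_collarTransport`,
`stub_coreIndependence`, `stub_prismIndependence`, `stub_sublevelTransfer`, `stub_spineAssembly`,
`stub_stabilization`; the landed glue (`stub_fillingUniqueness`, `stub_handlebodyExtension`,
`stub_dehnNielsenBaer`, `stub_coredReassembly`) is used as theorems. -/
theorem AgkCor6Sufficiency_of_stubStatements :
    exists_diffeomorph_comp_incl_eq.{0} → GriffithsExtension → DehnNielsenBaerSurfaceSmooth →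
    ThetaData → TubularZone → ZoneMap → HandlebodyMatch → SpineGerm → StandardCores →
    CollarTransport → CoreIndependence → PrismIndependence → SublevelTransfer →
    (ThetaData → TubularZone → ZoneMap → HandlebodyMatch → SpineGerm → StandardCores →
      CollarTransport → CoreIndependence → PrismIndependence → SublevelTransfer →
      HandlebodyExtension → SpineRigidityWithCores) →
    exists_stabilized_gkTrisection.{0} →
    ((∀ (k : ℕ) (K : TrisectionKernels (3 * k)),
        IsGroupTrisection (3 * k) k (PUnit : Type) K → K.IsStablyTrivial) →
      ∀ (M : Type) [TopologicalSpace M] [T2Space M] [SecondCountableTopology M],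
        ContinuousMap.HomotopyEquiv.NonemptyDiffeomorphSphere M 4) :=
  fun hLP hGr hDS h₁ h₂ h₃ h₄ h₅ h₆ h₇ h₈ h₉ h₁₀ hAsm hc =>
    cruxBody_of_two_leaves
      (rigidity_of_geometricRigidity_of_dnb
        (geometricRigidity_of_spine_of_cored (hAsm h₁ h₂ h₃ h₄ h₅ h₆ h₇ h₈ h₉ h₁₀)
          stub_coredReassembly (stub_fillingUniqueness hLP) (stub_handlebodyExtension hGr))
        (stub_dehnNielsenBaer hDS)) hc

/-- **The skeleton theorem: the crux BY NAME from the registered stubs**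
(`Summit.SmoothPoincare4.SmoothPoincare4.Theses.CongruenceShadows.AgkCor6Sufficiency`; `sorry`
occurs only inside the `stub_*` declarations it invokes). -/
theorem AgkCor6Sufficiency_of : AgkCor6Sufficiency :=
  AgkCor6Sufficiency_of_stubStatements stub_laudenbachPoenaru stub_griffiths stub_dnbSurface
    stub_thetaData stub_tubularZone stub_zoneMap stub_handlebodyMatch stub_spineGerm
    stub_standardCores stub_collarTransport stub_coreIndependence stub_prismIndependence
    stub_sublevelTransfer stub_spineAssembly stub_stabilization

/-- **The same for the shared decl of route `GroupTrisection`** (identical body). -/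
theorem AgkCor6Sufficiency_of' :
    Summit.SmoothPoincare4.SmoothPoincare4.Theses.GroupTrisection.AgkCor6Sufficiency :=
  AgkCor6Sufficiency_of_stubStatements stub_laudenbachPoenaru stub_griffiths stub_dnbSurface
    stub_thetaData stub_tubularZone stub_zoneMap stub_handlebodyMatch stub_spineGerm
    stub_standardCores stub_collarTransport stub_coreIndependence stub_prismIndependence
    stub_sublevelTransfer stub_spineAssembly stub_stabilization

end Summit.SmoothPoincare4.SmoothPoincare4.Cruxes.AgkCor6Sufficiency.LpBySphereSystemSurgery

end
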